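import Mathlib
import Literature.Geometry.DiscreteGeometry.CrystallographicGroups
import Summits.AtomisticToContinuum.Crystallization.Theorems.IsometryAtomsMinimisingLawsCohesiveGroupStructureAux1

/-!
# Sub-goal `groupStructure_invariantLine_of_finite_linParts` of stub `stub_groupStructure` — line `purity_stacking`, crux
# `IsometryAtoms.MinimisingLawsCohesive` (stmt-AtomisticToContinuum-15777)

Helper file for stub `stub_groupStructure` (F): the "invariant line" case of the structure theorem
for groups of isometries of `E = ℝ³`. If every linear part `L g` (`g ∈ Γ`) preserves the axis
`ℝ e` (`L g e = ± e`), every translation of `Γ` is along `e`, and `Γ` has only finitely many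
linear parts, then `Γ` leaves a line `c + ℝ e` invariant.

Proof (centroid argument in the plane `W = e^⊥`). Let `P x = x - ⟪x, e⟫ • e` be the orthogonal
projection onto `W`. For `g ∈ Γ` the linear part commutes with `P`, so `P (g x) = L g (P x) + P (g 0)`:
`Γ` acts on `W` by the affine maps `ω ↦ L g ω + P (g 0)`. The projected orbit of the origin
`Ω = {P (g 0) | g ∈ Γ}` is finite (two elements with the same linear part differ by a translation
`s • e`, which `P` kills), and `Γ` permutes `Ω`; hence the centroid `c` of `Ω` satisfies
`L g c + P (g 0) = c` for all `g ∈ Γ`, which says exactly that the line `c + ℝ e = {x | P x = c}` is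
mapped into itself by every `g ∈ Γ` (and onto, using `g⁻¹`).

Lands at
`Summits/AtomisticToContinuum/Crystallization/Theorems/IsometryAtomsMinimisingLawsCohesiveGroupStructureLineOrbit.lean`
with `--supports stmt-AtomisticToContinuum-15777`. Auxiliary lemmas are in the sub-namespace
`…GroupStructure.LineOrbit`; the projection is passed around as a function `P` together with its
defining equation `hP` (no definitions in this file).
-/

noncomputable section

open scoped RealInnerProductSpace
open Literature.Geometry.DiscreteGeometry.Crystallographic Module

namespace Summit.AtomisticToContinuum.Crystallization.Theorems.IsometryAtomsMinimisingLawsCohesive.GroupStructure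

namespace LineOrbit

/-! ## The projection `P x = x - ⟪x, e⟫ • e` onto the plane orthogonal to `e` -/

variable {e : EuclideanSpace ℝ (Fin 3)} {P : EuclideanSpace ℝ (Fin 3) → EuclideanSpace ℝ (Fin 3)}

/-- `P` is additive. -/
theorem proj_add (hP : ∀ x, P x = x - ⟪x, e⟫ • e) (x y : EuclideanSpace ℝ (Fin 3)) :
    P (x + y) = P x + P y := by
  rw [hP, hP, hP, inner_add_left, add_smul]
  abel

/-- `P` kills the multiples of the unit vector `e`. -/
theorem proj_smul_self (hP : ∀ x, P x = x - ⟪x, e⟫ • e) (he : ‖e‖ = 1) (s : ℝ) :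
    P (s • e) = 0 := by
  rw [hP, real_inner_smul_left, real_inner_self_eq_norm_sq, he, one_pow, mul_one, sub_self]

/-- `P x` is orthogonal to the unit vector `e`. -/
theorem inner_proj (hP : ∀ x, P x = x - ⟪x, e⟫ • e) (he : ‖e‖ = 1)
    (x : EuclideanSpace ℝ (Fin 3)) : ⟪P x, e⟫ = 0 := by
  rw [hP, inner_sub_left, real_inner_smul_left, real_inner_self_eq_norm_sq, he, one_pow, mul_one,
    sub_self]

/-- Vectors orthogonal to `e` are fixed by `P`. -/
theorem proj_eq_self_of_inner_eq_zero (hP : ∀ x, P x = x - ⟪x, e⟫ • e)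
    {x : EuclideanSpace ℝ (Fin 3)} (hx : ⟪x, e⟫ = 0) : P x = x := by
  rw [hP, hx, zero_smul, sub_zero]

/-- A linear isometry preserving the axis `± e` commutes with `P`. -/
theorem proj_linearIsometryEquiv (hP : ∀ x, P x = x - ⟪x, e⟫ • e)
    (l : EuclideanSpace ℝ (Fin 3) ≃ₗᵢ[ℝ] EuclideanSpace ℝ (Fin 3)) (hl : l e = e ∨ l e = -e)
    (x : EuclideanSpace ℝ (Fin 3)) : P (l x) = l (P x) := by
  rw [hP, hP, map_sub, LinearIsometryEquiv.map_smul]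
  rcases hl with h | h
  · have hinner : ⟪l x, e⟫ = ⟪x, e⟫ := by
      rw [← l.inner_map_map x e, h]
    rw [hinner, h]
  · have hinner : ⟪l x, e⟫ = -⟪x, e⟫ := by
      rw [← l.inner_map_map x e, h, inner_neg_right, neg_neg]
    rw [hinner, h, neg_smul, smul_neg]

/-- **Induced affine map on the plane**: if the linear part of the isometry `g` preserves the axis
`± e`, then `P (g x) = L g (P x) + P (g 0)`. -/
theorem proj_apply (hP : ∀ x, P x = x - ⟪x, e⟫ • e)
    (g : EuclideanSpace ℝ (Fin 3) ≃ᵢ EuclideanSpace ℝ (Fin 3))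
    (hg : g.toRealLinearIsometryEquiv e = e ∨ g.toRealLinearIsometryEquiv e = -e)
    (x : EuclideanSpace ℝ (Fin 3)) :
    P (g x) = g.toRealLinearIsometryEquiv (P x) + P (g 0) := by
  rw [apply_eq_lin_add g x, proj_add hP, proj_linearIsometryEquiv hP _ hg]

/-! ## The line `c + ℝ e` is the fibre `{x | P x = c}` -/

/-- For `c ⟂ e`, the affine line through `c` with direction `ℝ e` is `{x | P x = c}`. -/
theorem mem_line_iff (hP : ∀ x, P x = x - ⟪x, e⟫ • e) (he : ‖e‖ = 1)
    {c : EuclideanSpace ℝ (Fin 3)} (hc : ⟪c, e⟫ = 0) (x : EuclideanSpace ℝ (Fin 3)) :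
    x ∈ (AffineSubspace.mk' c (Submodule.span ℝ {e}) : Set (EuclideanSpace ℝ (Fin 3))) ↔ P x = c := by
  rw [SetLike.mem_coe, AffineSubspace.mem_mk', vsub_eq_sub, Submodule.mem_span_singleton]
  constructor
  · rintro ⟨a, ha⟩
    have hx : x = c + a • e := by
      rw [ha]
      abel
    rw [hx, proj_add hP, proj_smul_self hP he, add_zero, proj_eq_self_of_inner_eq_zero hP hc]
  · intro hx
    refine ⟨⟪x, e⟫, ?_⟩
    rw [← hx, hP, sub_sub_cancel]

/-! ## Centroids of finite sets permuted by an affine map -/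

/-- A map sending a finite set injectively into itself preserves the sum over it. -/
theorem sum_eq_of_mapsTo {S : Finset (EuclideanSpace ℝ (Fin 3))}
    (φ : EuclideanSpace ℝ (Fin 3) → EuclideanSpace ℝ (Fin 3)) (hinj : Function.Injective φ)
    (hmaps : ∀ ω ∈ S, φ ω ∈ S) : ∑ ω ∈ S, φ ω = ∑ ω ∈ S, ω := by
  classical
  have himage : S.image φ = S :=
    Finset.eq_of_subset_of_card_le (Finset.image_subset_iff.2 hmaps)
      (by rw [Finset.card_image_of_injective S hinj])
  have h := Finset.sum_image (f := fun ω : EuclideanSpace ℝ (Fin 3) => ω) (s := S) (g := φ)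
    hinj.injOn
  rw [himage] at h
  exact h.symm

/-- **Centroid lemma**: an affine map `ω ↦ l ω + t` (`l` a linear isometry) mapping a nonempty
finite set into itself fixes its centroid. -/
theorem lin_centroid_add_eq {S : Finset (EuclideanSpace ℝ (Fin 3))} (hS : S.Nonempty)
    (l : EuclideanSpace ℝ (Fin 3) ≃ₗᵢ[ℝ] EuclideanSpace ℝ (Fin 3)) (t : EuclideanSpace ℝ (Fin 3))
    (hmaps : ∀ ω ∈ S, l ω + t ∈ S) :
    l (((S.card : ℝ))⁻¹ • ∑ ω ∈ S, ω) + t = ((S.card : ℝ))⁻¹ • ∑ ω ∈ S, ω := by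
  have hinj : Function.Injective (fun ω => l ω + t) := fun a b hab =>
    l.injective (add_right_cancel hab)
  have hsum : ∑ ω ∈ S, (l ω + t) = ∑ ω ∈ S, ω := sum_eq_of_mapsTo (fun ω => l ω + t) hinj hmaps
  rw [Finset.sum_add_distrib, ← map_sum, Finset.sum_const, ← Nat.cast_smul_eq_nsmul ℝ] at hsum
  have hn : (S.card : ℝ) ≠ 0 := Nat.cast_ne_zero.2 (Finset.card_ne_zero.2 hS)
  have key : l (∑ ω ∈ S, ω) = ∑ ω ∈ S, ω - (S.card : ℝ) • t := eq_sub_of_add_eq hsum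
  rw [LinearIsometryEquiv.map_smul, key, smul_sub, smul_smul, inv_mul_cancel₀ hn, one_smul,
    sub_add_cancel]

/-- The centroid of a finite set of vectors orthogonal to `e` is orthogonal to `e`. -/
theorem inner_centroid_eq_zero {S : Finset (EuclideanSpace ℝ (Fin 3))}
    (hS : ∀ ω ∈ S, ⟪ω, e⟫ = 0) : ⟪((S.card : ℝ))⁻¹ • ∑ ω ∈ S, ω, e⟫ = 0 := by
  rw [real_inner_smul_left, sum_inner, Finset.sum_eq_zero hS, mul_zero]

/-! ## The projected orbit of the origin -/

variable {Γ : Subgroup (EuclideanSpace ℝ (Fin 3) ≃ᵢ EuclideanSpace ℝ (Fin 3))}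

/-- Two elements of `Γ` with the same linear part have the same projected translation part:
they differ by a translation of `Γ`, which is along `e`. -/
theorem proj_apply_zero_eq_of_lin_eq (hP : ∀ x, P x = x - ⟪x, e⟫ • e) (he : ‖e‖ = 1)
    (haxis : ∀ g ∈ Γ, g.toRealLinearIsometryEquiv e = e ∨ g.toRealLinearIsometryEquiv e = -e)
    (htrans : ∀ v ∈ translationVectors Γ, ∃ s : ℝ, v = s • e)
    {g h : EuclideanSpace ℝ (Fin 3) ≃ᵢ EuclideanSpace ℝ (Fin 3)} (hg : g ∈ Γ) (hh : h ∈ Γ)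
    (hlin : g.toRealLinearIsometryEquiv = h.toRealLinearIsometryEquiv) : P (h 0) = P (g 0) := by
  obtain ⟨-, hmem⟩ := sub_mem_translationVectors_of_lin_eq Γ hg hh hlin
  obtain ⟨s, hs⟩ := htrans _ hmem
  have h2 : h 0 = g (s • e) := by
    rw [← hs, IsometryEquiv.mul_apply, IsometryEquiv.apply_inv_self]
  rw [h2, proj_apply hP g (haxis g hg), proj_smul_self hP he, map_zero, zero_add]

/-- **Finiteness of the projected orbit** `{P (g 0) | g ∈ Γ}`: it is the union, over the finitely
many linear parts, of subsingletons. -/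
theorem finite_projOrbit (hP : ∀ x, P x = x - ⟪x, e⟫ • e) (he : ‖e‖ = 1)
    (haxis : ∀ g ∈ Γ, g.toRealLinearIsometryEquiv e = e ∨ g.toRealLinearIsometryEquiv e = -e)
    (htrans : ∀ v ∈ translationVectors Γ, ∃ s : ℝ, v = s • e)
    (hfin : ((fun g : EuclideanSpace ℝ (Fin 3) ≃ᵢ EuclideanSpace ℝ (Fin 3) =>
      g.toRealLinearIsometryEquiv) ''
      (Γ : Set (EuclideanSpace ℝ (Fin 3) ≃ᵢ EuclideanSpace ℝ (Fin 3)))).Finite) :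
    ((fun g : EuclideanSpace ℝ (Fin 3) ≃ᵢ EuclideanSpace ℝ (Fin 3) => P (g 0)) ''
      (Γ : Set (EuclideanSpace ℝ (Fin 3) ≃ᵢ EuclideanSpace ℝ (Fin 3)))).Finite := by
  refine (hfin.biUnion
    (t := fun l => {w | ∃ g ∈ Γ, g.toRealLinearIsometryEquiv = l ∧ w = P (g 0)})
    fun l _ => ?_).subset ?_
  · refine Set.Subsingleton.finite ?_
    rintro w ⟨g, hg, hgl, rfl⟩ w' ⟨g', hg', hg'l, rfl⟩
    exact proj_apply_zero_eq_of_lin_eq hP he haxis htrans hg' hg (hg'l.trans hgl.symm)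
  · rintro w ⟨g, hg, rfl⟩
    exact Set.mem_biUnion (x := g.toRealLinearIsometryEquiv) ⟨g, hg, rfl⟩ ⟨g, hg, rfl, rfl⟩

/-- **The centre of the projected orbit**: there is `c ⟂ e` with `L γ c + P (γ 0) = c` for every
`γ ∈ Γ` (the centroid of the finite set `{P (g 0) | g ∈ Γ}`, which `Γ` permutes). -/
theorem exists_center (hP : ∀ x, P x = x - ⟪x, e⟫ • e) (he : ‖e‖ = 1)
    (haxis : ∀ g ∈ Γ, g.toRealLinearIsometryEquiv e = e ∨ g.toRealLinearIsometryEquiv e = -e)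
    (htrans : ∀ v ∈ translationVectors Γ, ∃ s : ℝ, v = s • e)
    (hfin : ((fun g : EuclideanSpace ℝ (Fin 3) ≃ᵢ EuclideanSpace ℝ (Fin 3) =>
      g.toRealLinearIsometryEquiv) ''
      (Γ : Set (EuclideanSpace ℝ (Fin 3) ≃ᵢ EuclideanSpace ℝ (Fin 3)))).Finite) :
    ∃ c : EuclideanSpace ℝ (Fin 3), ⟪c, e⟫ = 0 ∧
      ∀ γ ∈ Γ, γ.toRealLinearIsometryEquiv c + P (γ 0) = c := by
  have hΩ := finite_projOrbit hP he haxis htrans hfin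
  have hmemS : ∀ ω, ω ∈ hΩ.toFinset ↔
      ∃ g ∈ (Γ : Set (EuclideanSpace ℝ (Fin 3) ≃ᵢ EuclideanSpace ℝ (Fin 3))), P (g 0) = ω :=
    fun ω => by rw [Set.Finite.mem_toFinset, Set.mem_image]
  have hne : hΩ.toFinset.Nonempty :=
    ⟨P ((1 : EuclideanSpace ℝ (Fin 3) ≃ᵢ EuclideanSpace ℝ (Fin 3)) 0), (hmemS _).2 ⟨1, Γ.one_mem, rfl⟩⟩
  refine ⟨((hΩ.toFinset.card : ℝ))⁻¹ • ∑ ω ∈ hΩ.toFinset, ω, inner_centroid_eq_zero ?_,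
    fun γ hγ => lin_centroid_add_eq hne _ _ ?_⟩
  · intro ω hω
    obtain ⟨g, -, rfl⟩ := (hmemS ω).1 hω
    exact inner_proj hP he _
  · intro ω hω
    obtain ⟨g, hg, rfl⟩ := (hmemS ω).1 hω
    refine (hmemS _).2 ⟨γ * g, Γ.mul_mem hγ hg, ?_⟩
    rw [IsometryEquiv.mul_apply, proj_apply hP γ (haxis γ hγ)]

end LineOrbit

/-- **Sub-goal `groupStructure_invariantLine_of_finite_linParts`**: let `Γ` be a group of
isometries of `ℝ³` and `e` a unit vector such that every linear part `L g` (`g ∈ Γ`) satisfies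
`L g e = ± e`, every translation vector of `Γ` is a multiple of `e`, and `Γ` has finitely many
linear parts. Then some line `c + ℝ e` is invariant under every `g ∈ Γ`.

Proof sketch: with `P x = x - ⟪x, e⟫ • e` one has `P (g x) = L g (P x) + P (g 0)`; the projected
orbit `{P (g 0) | g ∈ Γ}` is finite and permuted by these affine maps, so its centroid `c`
satisfies `L g c + P (g 0) = c` (`LineOrbit.exists_center`), i.e. `g` maps the fibre
`{x | P x = c} = c + ℝ e` (`LineOrbit.mem_line_iff`) into itself; equality follows from `g⁻¹ ∈ Γ`. -/
theorem groupStructure_invariantLine_of_finite_linParts : ∀ Γ : Subgroup (EuclideanSpace ℝ (Fin 3) ≃ᵢ EuclideanSpace ℝ (Fin 3)), ∀ e : EuclideanSpace ℝ (Fin 3), ‖e‖ = 1 → (∀ g ∈ Γ, g.toRealLinearIsometryEquiv e = e ∨ g.toRealLinearIsometryEquiv e = -e) → (∀ v ∈ Literature.Geometry.DiscreteGeometry.Crystallographic.translationVectors Γ, ∃ s : ℝ, v = s • e) → ((fun g : EuclideanSpace ℝ (Fin 3) ≃ᵢ EuclideanSpace ℝ (Fin 3) => g.toRealLinearIsometryEquiv)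 '' (Γ : Set (EuclideanSpace ℝ (Fin 3) ≃ᵢ EuclideanSpace ℝ (Fin 3)))).Finite → ∃ c : EuclideanSpace ℝ (Fin 3), ∀ g ∈ Γ, g '' (AffineSubspace.mk' c (Submodule.span ℝ {e}) : Set (EuclideanSpace ℝ (Fin 3))) = AffineSubspace.mk' c (Submodule.span ℝ {e}) := by
  intro Γ e he haxis htrans hfin
  obtain ⟨P, hP⟩ : ∃ P : EuclideanSpace ℝ (Fin 3) → EuclideanSpace ℝ (Fin 3),
      ∀ x, P x = x - ⟪x, e⟫ • e := ⟨_, fun _ => rfl⟩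
  obtain ⟨c, hc, hcen⟩ := LineOrbit.exists_center hP he haxis htrans hfin
  refine ⟨c, fun g hg => ?_⟩
  have hmaps : ∀ γ ∈ Γ, Set.MapsTo γ
      (AffineSubspace.mk' c (Submodule.span ℝ {e}) : Set (EuclideanSpace ℝ (Fin 3)))
      (AffineSubspace.mk' c (Submodule.span ℝ {e}) : Set (EuclideanSpace ℝ (Fin 3))) := by
    intro γ hγ x hx
    rw [LineOrbit.mem_line_iff hP he hc] at hx ⊢
    rw [LineOrbit.proj_apply hP γ (haxis γ hγ), hx, hcen γ hγ]
  refine Set.Subset.antisymm (hmaps g hg).image_subset fun y hy => ?_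
  exact ⟨g⁻¹ y, hmaps g⁻¹ (Γ.inv_mem hg) hy, IsometryEquiv.apply_inv_self g y⟩

end Summit.AtomisticToContinuum.Crystallization.Theorems.IsometryAtomsMinimisingLawsCohesive.GroupStructure

end
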